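import Summits.BirchSwinnertonDyer.BirchSwinnertonDyer.Theorems.GenusKolyvaginAtTwoKramerParityHolds
import HarnessLib

/-!
# Route `GenusKolyvaginAtTwo`, crux #2 `GenusPrimitiveSupplyAtTwo` (stmt-BirchSwinnertonDyer-22136):
# KRAMER'S CONGRUENCE FOR THE GEOMETRIC IDENTIFICATION `E^d[2] = E[2]` — NO image / uniqueness hypothesis

Lead seat `bsd-line-gk2-p1` g10 (cell `bsd-f1-sign2`).  The tree's named fact `MazurRubin2010.kramerParity K` (now the theorem
`GenusKolyPR.kramerParity_holds`) quantifies over an identification `φ : E'[2] ≅ E[2]` that is UNIQUE among injective intertwining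
maps — a clause that is only satisfiable when `E[2]` has no non-trivial `Γ_K`-automorphism (e.g. `ρ̄_{E,2}` onto).  Mazur–Rubin's
Thm. 2.7 is stated for THE identification `E^F[2] = E[2]` (`x ↦ x` on the models `y² = f(x)`, `d y² = f(x)`).  With the explicit
twist identification of the Literature chain (`ThetaLevelTwo.twistTorsionMap`, `x' = u²d·x + r`) and the transport law
`prClass_map_twistTorsionMap` (KMR Lemma 5.2 for the explicit Poonen–Rains form), the uniqueness clause is not needed:

* `prForm_map_twistTorsionMap_eq_zero` — (Q4) for THE geometric identification: `q_{E,v}` kills `(twistTorsionMap)_* 𝓚_{E',v}`;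
* **`kramerParity_twistTorsionMap`** — Kramer's congruence (MR 2010 Thm. 2.7, tree `IsSquare` spelling) for EVERY elliptic `E/K`,
  EVERY non-square `d`, EVERY model `E'` of `E^{(d)}` (`C • W' = W.quadraticTwist d`) and the Selmer structure
  `𝓐_v := (twistTorsionMap)_* 𝓚_{E',v}`: `#H¹_𝓐 · #Sel₂(E) · ∏_{v∈S} [𝓚_v : 𝓐_v ∩ 𝓚_v]` is a square, with `#H¹_𝓐 = #Sel₂(E')`
  — no hypothesis on `ρ̄_{E,2}`.  Proof = the width seat's `kramerParity_of_tateQuadraticForms` body (KMR Thm. 3.9 engine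
  `isSquare_card_selmerGroup_mul_of_tateQuadraticForms`, Poitou–Tate family `poitouTate_selmerStructure_duality_real_holds`, Tate χ
  `localEulerPoincareCharacteristic_holds`) with the datum `(prWeilN, prForm)` and (Q4) replaced by the first bullet.

THEOREMS ONLY (no definition, no named fact, no `sorry`); helper `--supports stmt-BirchSwinnertonDyer-22136`; crux 22136 stays OPEN at
(U) ∧ (CONV₂); BSD is not proved by any of this.

References: [MazurRubin2010] Thm. 2.7, Remark 2.4; [KlagsbrunMazurRubin2013] Thm. 3.9, Lemma 5.2; [PoonenRains2012] §4.
-/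

set_option linter.dupNamespace false -- tree convention: `Summit.BirchSwinnertonDyer.BirchSwinnertonDyer.Theorems` (summit = sub-problem)
set_option autoImplicit false

noncomputable section

open scoped Classical ContRepresentation

namespace Summit.BirchSwinnertonDyer.BirchSwinnertonDyer.Theorems.GenusKolyPR

open WeierstrassCurve Field NumberField IsDedekindDomain Function Module
open Literature.NumberTheory.EllipticCurves Literature.NumberTheory.EllipticCurves.ThetaLevelTwo
open Literature.NumberTheory.GaloisRepresentations
open Literature.NumberTheory.GaloisRepresentations.DiscreteGaloisModule (SelmerStructure)
open Literature.NumberTheory.GaloisCohomology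
open Summit.BirchSwinnertonDyer.Rank1Residual
open Summit.BirchSwinnertonDyer.Rank1Residual.X11b.FiniteDuality
open Summit.BirchSwinnertonDyer.Rank1Residual.X11b.Relaxation
open Summit.BirchSwinnertonDyer.Rank1Residual.X11b.LocBridge
open Summit.BirchSwinnertonDyer.BirchSwinnertonDyer.Theorems.GenusKolyKramer

variable {K : Type} [Field K] [NumberField K]

/-- **(Q4) for THE geometric identification**: for `C • W' = W^{(d)}` and every place `v`, the Poonen–Rains form `q_{W,v}` kills the
Kummer condition of `W'` transported along `twistTorsionMap` (no uniqueness / image hypothesis): `prClass_map_twistTorsionMap`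
(KMR Lemma 5.2, explicit) and (Q2) for `W'`. [cite: KlagsbrunMazurRubin2013, Lemma 5.2] [cite: PoonenRains2012, Prop. 4.8] -/
theorem prForm_map_twistTorsionMap_eq_zero (W : WeierstrassCurve K) [W.IsElliptic] (h2 : (2 : K) ≠ 0) (d : K)
    (hd : ∀ x : K, x ^ 2 ≠ d) (W' : WeierstrassCurve K) [W'.IsElliptic] (C : VariableChange K) (hC : C • W' = W.quadraticTwist d)
    (v : Place K) (x' : galoisCohomology ((W'.torsionGaloisModule ((2 : ℕ) : ℤ)).toLocal v) 1)
    (hx' : x' ∈ W'.kummerSelmerStructure ((2 : ℕ) : ℤ) v) :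
    prForm W h2 v (galoisCohomology.map
      ((show (W'.torsionGaloisModule ((2 : ℕ) : ℤ)).toContRepresentation →ⁱL
          (W.torsionGaloisModule ((2 : ℕ) : ℤ)).toContRepresentation from twistTorsionMap W W' h2 d C hC hd).restrictField
        (Place.Completion v)) 1 x') = 0 := by
  have hQ2 := prForm_eq_zero_of_mem_kummer W' h2 v x' hx'
  have key := prClass_map_twistTorsionMap W W' h2 d C hC hd (Place.Completion v)
    (show galoisCohomology (GaloisRep.restrictField (Place.Completion v) (W'.torsionGaloisModule 2)) 1 from x')
  unfold prForm at hQ2 ⊢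
  rw [← key] at hQ2
  exact hQ2

/-- **KRAMER'S CONGRUENCE FOR THE GEOMETRIC IDENTIFICATION `E^d[2] = E[2]`, every elliptic `E` over every number field, no image
hypothesis** (Mazur–Rubin 2010 Thm. 2.7 in the tree's `IsSquare` spelling): for a non-square `d`, a model `W'` of the twist
(`C • W' = W.quadraticTwist d`), the Selmer structure `𝓐_v = (twistTorsionMap)_* 𝓚_{W',v}` on `E[2]` and every finite `S` off which
`𝓐 = 𝓚_W`: `#H¹_𝓐 · #Sel₂(W) · ∏_{v∈S} [𝓚_{W,v} : 𝓐_v ∩ 𝓚_{W,v}]` is a perfect square, and `#H¹_𝓐 = #Sel₂(W')`.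
[cite: MazurRubin2010, Thm. 2.7 with Remark 2.4] [cite: KlagsbrunMazurRubin2013, Thm. 3.9 and Lemma 5.2] [cite: PoonenRains2012, Thm. 4.14] -/
theorem kramerParity_twistTorsionMap (W : WeierstrassCurve K) [W.IsElliptic] (d : K) (hd : ∀ x : K, x ^ 2 ≠ d)
    (W' : WeierstrassCurve K) [W'.IsElliptic] (C : VariableChange K) (hC : C • W' = W.quadraticTwist d)
    (𝓐 : SelmerStructure (W.torsionGaloisModule ((2 : ℕ) : ℤ)))
    (h𝓐 : ∀ v, 𝓐 v = (W'.kummerSelmerStructure ((2 : ℕ) : ℤ) v).map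
      (galoisCohomology.map
        ((show (W'.torsionGaloisModule ((2 : ℕ) : ℤ)).toContRepresentation →ⁱL
            (W.torsionGaloisModule ((2 : ℕ) : ℤ)).toContRepresentation
          from twistTorsionMap W W' two_ne_zero d C hC hd).restrictField (Place.Completion v)) 1))
    (S : Finset (Place K)) (hS : ∀ v ∉ S, 𝓐 v = W.kummerSelmerStructure ((2 : ℕ) : ℤ) v) :
    IsSquare (Nat.card (W'.selmerGroup ((2 : ℕ) : ℤ)) * Nat.card (W.selmerGroup ((2 : ℕ) : ℤ)) *
      ∏ v ∈ S, (𝓐 v).relIndex (W.kummerSelmerStructure ((2 : ℕ) : ℤ) v)) := by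
  classical
  have h2 : (2 : K) ≠ 0 := two_ne_zero
  haveI : NeZero (2 : ℕ) := ⟨two_ne_zero⟩
  haveI : PerfectField K := PerfectField.ofCharZero
  -- the Poitou–Tate family and Tate χ (tree theorems)
  obtain ⟨inv, hperf, hsum, -, hcompl, hreal⟩ :=
    SchneiderFreeAdditiveX3.PoitouTateReduction.poitouTate_selmerStructure_duality_real_holds (K := K) 2
  have hEP : ∀ v : HeightOneSpectrum (𝓞 K), localEulerPoincareCharacteristic (v.adicCompletion K) := fun v ↦
    haveI : CharZero (v.adicCompletion K) := charZero_of_injective_algebraMap (algebraMap K _).injective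
    localEulerPoincareCharacteristic_holds (v.adicCompletion K)
  -- the Poonen–Rains datum of `W`
  have hpolar : ∀ v x y, prForm W h2 v (x + y) = prForm W h2 v x + prForm W h2 v y +
      invWeilPairing W 2 (prWeilN W h2) (prWeilN_sq W h2) (prWeilN_add_left W h2) (prWeilN_add_right W h2)
        (smul_prWeilN W h2) inv v x y := fun v x y => by
    rw [prForm_add, invWeilPairing_eq_canonical_two W (prWeilN W h2) (prWeilN_sq W h2)
      (prWeilN_add_left W h2) (prWeilN_add_right W h2) (smul_prWeilN W h2) inv hperf hreal, invWeilPairing_apply]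
  -- the identification and its inverse
  let φ : (W'.torsionGaloisModule ((2 : ℕ) : ℤ)).toContRepresentation →ⁱL
      (W.torsionGaloisModule ((2 : ℕ) : ℤ)).toContRepresentation := twistTorsionMap W W' two_ne_zero d C hC hd
  have hφ : Function.Injective φ := twistTorsionMap_injective W W' two_ne_zero d C hC hd
  obtain ⟨e', hμ', hadd₁', hadd₂', halt', hnondeg', hgal'⟩ := exists_weilPairing_holds W' 2 le_rfl (by norm_num)
  have hcard : Nat.card (geomTorsion W' ((2 : ℕ) : ℤ)) = Nat.card (geomTorsion W ((2 : ℕ) : ℤ)) := by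
    rw [W'.natCard_geomTorsion (n := ((2 : ℕ) : ℤ)) (by norm_num), W.natCard_geomTorsion (n := ((2 : ℕ) : ℤ)) (by norm_num)]
  haveI : Finite (geomTorsion W ((2 : ℕ) : ℤ)) := finite_geomTorsion_of_neZero W 2
  haveI : Finite (geomTorsion W' ((2 : ℕ) : ℤ)) := finite_geomTorsion_of_neZero W' 2
  have hbij : Function.Bijective φ := hφ.bijective_of_nat_card_le hcard.ge
  obtain ⟨ψ, hψφ, hφψ⟩ := exists_inverse_of_bijective φ hbij
  -- `#H¹_𝓐 = #Sel₂(W')` and `Sel₂(W) = H¹_𝓚`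
  have hSelA : Nat.card 𝓐.selmerGroup = Nat.card (W'.selmerGroup ((2 : ℕ) : ℤ)) := by
    rw [W'.selmerGroup_eq_selmerGroup_kummerSelmerStructure]
    exact X11b.CongruentTransfer.natCard_selmerGroup_of_transport _ φ ψ hψφ hφψ 𝓐 h𝓐
  have hSelK : Nat.card (W.selmerGroup ((2 : ℕ) : ℤ)) =
      Nat.card (W.kummerSelmerStructure ((2 : ℕ) : ℤ)).selmerGroup :=
    Nat.card_congr (Equiv.subtypeEquivRight fun c =>
      (W.mem_selmerGroup_iff_forall_localization_mem _ c).trans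
        ((W.kummerSelmerStructure ((2 : ℕ) : ℤ)).mem_selmerGroup_iff c).symm)
  -- `#𝓐_v = #𝓚_v`
  have hcardA : ∀ v ∈ S, Nat.card (𝓐 v) = Nat.card (W.kummerSelmerStructure ((2 : ℕ) : ℤ) v) := by
    intro v _
    have h1 : Nat.card (𝓐 v) = Nat.card (W'.kummerSelmerStructure ((2 : ℕ) : ℤ) v) := by
      rw [h𝓐 v]
      exact Nat.card_congr (AddSubgroup.equivMapOfInjective _ _
        (X11b.CongruentTransfer.map_restrictField_injective_of_comp_eq φ ψ hψφ v)).toEquiv.symm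
    have h2' : Nat.card (galoisCohomology ((W'.torsionGaloisModule ((2 : ℕ) : ℤ)).toLocal v) 1) =
        Nat.card (galoisCohomology ((W.torsionGaloisModule ((2 : ℕ) : ℤ)).toLocal v) 1) := by
      refine Nat.card_eq_of_bijective (galoisCohomology.map (φ.restrictField (Place.Completion v)) 1) ⟨?_, ?_⟩
      · exact X11b.CongruentTransfer.map_restrictField_injective_of_comp_eq φ ψ hψφ v
      · intro y
        exact ⟨galoisCohomology.map (ψ.restrictField (Place.Completion v)) 1 y,
          X11b.CongruentTransfer.map_restrictField_map_restrictField_of_comp_eq ψ φ hφψ v y⟩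
    have hW := natCard_kummerSelmerStructure_mul_self W 2 (prWeilN W h2) (prWeilN_sq W h2) (prWeilN_add_left W h2)
      (prWeilN_add_right W h2) (smul_prWeilN W h2) (prWeilN_self W h2) (eq_zero_of_prWeilN_eq_one W h2) inv
      Nat.prime_two.isPrimePow hperf hEP hreal v
    have hW' := natCard_kummerSelmerStructure_mul_self W' 2 e' hμ' hadd₁' hadd₂' hgal' halt' hnondeg' inv
      Nat.prime_two.isPrimePow hperf hEP hreal v
    rw [h1]
    rw [h2', ← hW] at hW'
    exact Nat.mul_self_inj.mp hW'
  -- (Q4) for THE identification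
  have hisoA : ∀ v, ∀ x ∈ 𝓐 v, prForm W h2 v x = 0 := by
    intro v x hx
    rw [h𝓐 v] at hx
    obtain ⟨x', hx', rfl⟩ := AddSubgroup.mem_map.mp hx
    exact prForm_map_twistTorsionMap_eq_zero W h2 d hd W' C hC v x' hx'
  have key := isSquare_card_selmerGroup_mul_of_tateQuadraticForms W (prWeilN W h2) (prWeilN_sq W h2) (prWeilN_add_left W h2)
    (prWeilN_add_right W h2) (smul_prWeilN W h2) (prWeilN_self W h2) (eq_zero_of_prWeilN_eq_one W h2) inv hperf hsum
    hcompl hreal hEP (prForm W h2) hpolar (fun v x hx => prForm_eq_zero_of_mem_kummer W h2 v x hx)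
    (tateQuadraticForm_prClass_Q3 W h2) 𝓐 S hS hisoA hcardA
  rw [hSelA, ← hSelK] at key
  exact key

/-- The tree's named fact under its own name: `MazurRubin2010.kramerParity K` holds (alias of `GenusKolyPR.kramerParity_holds`,
for the fact registry). [cite: MazurRubin2010, Thm. 2.7] [cite: Kramer1981, Thm. 1] -/
theorem _root_.Literature.NumberTheory.EllipticCurves.MazurRubin2010.kramerParity_holds (K : Type) [Field K] [NumberField K] :
    MazurRubin2010.kramerParity K :=
  GenusKolyPR.kramerParity_holds

end Summit.BirchSwinnertonDyer.BirchSwinnertonDyer.Theorems.GenusKolyPR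

end
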